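import Summits.NavierStokesRegularity.NavierStokesRegularity.Theses.AxisymmetricExtremality
import Summits.NavierStokesRegularity.NavierStokesRegularity.Theorems.AxisymmetricExtremalityAxisymmetricKatoGlobalStubSeregin2020TypeIISwirlVanishesRepr
import Summits.NavierStokesRegularity.NavierStokesRegularity.Theorems.AxisymmetricExtremalityAxisymmetricKatoGlobalStubSeregin2020TypeIINoSwirlCoreRim
import HarnessLib

/-!
# Seregin 2020, proof of Thm 2.1, the `Γ ≡ 0` step: `∂ₜΠ`, `∇Π`, `∇²Π` are bounded on the boxes
# `]-ρ², 0[ × P(δ, ρ; ρ)` off the axis, up to the top time (the clause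
# "`π ∈ W^{2,1}_2(P(δ, R; R) × ]-R², 0[)`" of the class 𝒱 of Lemma 2.2, for `Π = c + s Γ`)

Helper toward the stub `stub_seregin2020TypeII` of the crux `AxisymmetricKatoGlobal` (= the named
fact `Literature.Analysis.FluidPDE.Seregin2020_axisymmetricSingularPoint_typeII`, G. Seregin,
Anal. Math. Phys. 10 (2020) Paper 46 = arXiv:2006.04140, Thm 2.1). The class 𝒱 of Lemma 2.2
(arXiv p. 8) asks `π ∈ W^{2,1}_2(P(δ, R; R) × ]-R², 0[) ∩ L_∞(Q₋)` for all `0 < δ < R`,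
`P(a, b; h) = {a < |x'| < b, |x₃| < h}`; for `Γ` the paper argues "`|∂ₜΓ - ΔΓ| ≤ (sup |u| + 2/δ)|∇Γ|`
… since `u` is axially symmetric, the first factor is finite" — i.e. the velocity is bounded on
these boxes UP TO the top time `t = 0`, off the axis. In the tree's classical rendering of 𝒱 this
clause is: `∂ₜΠ`, `∇Π` and the second derivatives `∂ₑ∂ₑΠ`, `|e| ≤ 1`, are bounded on every box
`]-ρ², 0[ × P(δ, ρ; ρ)`. This file proves it for `Π = c + s Γ`, `Γ = swirl V`, `V` the global
smooth representative of the ancient limit (`exists_smooth_repr_off_backwardSingular`):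

* `exists_norm_iteratedFDeriv_le_offAxisBox` — every `D_xⁿ V` is bounded on the box: below the
  top time by continuity, at the top face `{0} × P̄` by the backward regularity of the off-axis
  (hence backward-bounded) points `(0, x)` (`exists_norm_iteratedFDeriv_le_of_backward_bounded`),
  assembled by a compactness (subsequence) argument;
* `affSwirl_classV_bounds` — the bounds for `∂ₜΠ = s(ΔΓ - DΓ[V] - (2/ϱ)∂_ϱΓ)`, `∇Π = s∇Γ`,
  `∂ₑ∂ₑΠ = s ∂ₑ∂ₑΓ` through the tree's formulas `DΓ e = ⟪Jx, DV e⟫ + ⟪Je, V⟫`,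
  `∂ₑ∂ₑΓ = ⟪Jx, D²V(e,e)⟫ + 2⟪Je, DV e⟫`, `ΔΓ = ⟪Jx, ΔV⟫ + 2(∂₀V₁ - ∂₁V₀)`, `|Jx| = |x'| < ρ`.

## References

* G. Seregin, Anal. Math. Phys. 10 (2020), Paper 46 = arXiv:2006.04140, proof of Thm. 2.1, the
  paragraph on `Γ ∈ W^{2,1}_p(P(δ, R; R) × ]-R², 0[)` and the class 𝒱 (ii) (arXiv p. 8). [Seregin2020]
-/

-- the problem directory repeats the summit name (D-0017); core's `dupNamespace` linter fires
set_option linter.dupNamespace false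

noncomputable section

open MeasureTheory Set Function Filter Topology TopologicalSpace Metric
open scoped NNReal ENNReal Laplacian RealInnerProductSpace

namespace Summit.NavierStokesRegularity.NavierStokesRegularity.Theorems.AxisymmetricKatoGlobal.EulerScaling

open Literature.Analysis.FluidPDE Literature.Analysis.FluidPDE.SereginZajaczkowski2007
  Literature.Analysis.FluidPDE.Seregin2020

section Bounds

variable {w V : ℝ → EuclideanSpace ℝ (Fin 3) → EuclideanSpace ℝ (Fin 3)}
  {π : ℝ → EuclideanSpace ℝ (Fin 3) → ℝ} {A : Set (ℝ × EuclideanSpace ℝ (Fin 3))}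

/-! ### Uniform bounds of the spatial derivatives of `V` on the boxes, up to the top -/

/-- **Every spatial derivative `D_xⁿ V` of the global representative is bounded on the box
`]-ρ², 0[ × {δ < |x'| < ρ, |x₃| < ρ}`, `0 < δ < ρ`, up to the top time.** By contradiction: a
sequence in the box with `‖DⁿV‖ → ∞` accumulates (compactness of `[-ρ², 0] × B̄(0, 2ρ)`) at a
point `z* = (t*, x*)` with `t* ≤ 0`, `|x*'| ≥ δ`; if `t* < 0`, `DⁿV` is continuous at `z*` (the
class off the axis); if `t* = 0`, `(0, x*)` is off the axis, hence backward bounded, and `DⁿV` is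
bounded on a backward cylinder `Q((0, x*), r')`, which contains the tail of the sequence.
[cite: Seregin2020, proof of Thm 2.1, "Γ ∈ W^{2,1}_p(P(δ,R;R) × ]-R²,0[)" (arXiv p. 8)] -/
theorem exists_norm_iteratedFDeriv_le_offAxisBox
    (hball : ∀ a : ℝ, 0 < a → IsSuitableWeakSolutionInBall a 0 w π)
    (hA : A = {z : ℝ × EuclideanSpace ℝ (Fin 3) | z.1 ≤ 0 ∧
      ¬ ∃ r > 0, eLpNorm (uncurry w) ∞ (volume.restrict (parabolicCylinder r z)) < ∞})
    (haxis : ∀ z ∈ A, cylRadius z.2 = 0)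
    (hVae : ∀ a : ℝ, 0 < a →
      uncurry w =ᵐ[volume.restrict (parabolicCylinder a (0 : ℝ × EuclideanSpace ℝ (Fin 3)))]
        uncurry V)
    (hVcl : ∀ a : ℝ, 0 < a → ∀ O : Opens (ℝ × EuclideanSpace ℝ (Fin 3)),
      (O : Set (ℝ × EuclideanSpace ℝ (Fin 3))) ⊆
        parabolicCylinder a (0 : ℝ × EuclideanSpace ℝ (Fin 3)) \ A →
      (∀ θ : ℝ, ∀ z ∈ (O : Set (ℝ × EuclideanSpace ℝ (Fin 3))),
        ((z.1, rotZ θ z.2) : ℝ × EuclideanSpace ℝ (Fin 3)) ∈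
          (O : Set (ℝ × EuclideanSpace ℝ (Fin 3)))) →
      IsSmoothAxisymmetricSolutionOn O V π)
    {δ ρ : ℝ} (hδ : 0 < δ) (n : ℕ) :
    ∃ C : ℝ, ∀ z : ℝ × EuclideanSpace ℝ (Fin 3), z.1 ∈ Ioo (-ρ ^ 2) 0 → δ < cylRadius z.2 →
      cylRadius z.2 < ρ → |z.2 2| < ρ → ‖iteratedFDeriv ℝ n (V z.1) z.2‖ ≤ C := by
  by_contra H
  push Not at H
  choose x hx using fun k : ℕ => H k
  set F : ℝ × EuclideanSpace ℝ (Fin 3) → ℝ := fun z => ‖iteratedFDeriv ℝ n (V z.1) z.2‖ with hF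
  have hxF : ∀ k : ℕ, (k : ℝ) < F (x k) := fun k => (hx k).2.2.2.2
  -- the sequence lies in the compact `[-ρ², 0] × B̄(0, 2ρ)`
  have hKc : IsCompact (Icc (-ρ ^ 2) 0 ×ˢ closedBall (0 : EuclideanSpace ℝ (Fin 3)) (2 * ρ)) :=
    isCompact_Icc.prod (isCompact_closedBall _ _)
  have hmem : ∀ k, x k ∈ Icc (-ρ ^ 2) 0 ×ˢ closedBall (0 : EuclideanSpace ℝ (Fin 3)) (2 * ρ) := by
    intro k
    obtain ⟨ht, hδk, hρk, h3, -⟩ := hx k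
    refine ⟨Ioo_subset_Icc_self ht, ?_⟩
    rw [mem_closedBall, dist_zero_right]
    have h1 : ‖(x k).2‖ ^ 2 = cylRadius (x k).2 ^ 2 + (x k).2 2 ^ 2 := SereginSverak2009.norm_sq_eq_cylRadius_sq_add _
    have h2 : (x k).2 2 ^ 2 < ρ ^ 2 := by
      have := abs_lt.1 h3
      nlinarith
    have hc0 : 0 ≤ cylRadius (x k).2 := cylRadius_nonneg _
    nlinarith [norm_nonneg ((x k).2)]
  obtain ⟨zs, -, φ, hφ, hlim⟩ := hKc.tendsto_subseq hmem
  -- the limit point: `t* ≤ 0`, `|x*'| ≥ δ`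
  have ht : zs.1 ≤ 0 :=
    le_of_tendsto' ((continuous_fst.tendsto zs).comp hlim) fun k => (hx (φ k)).1.2.le
  have hρs : δ ≤ cylRadius zs.2 :=
    ge_of_tendsto' (((continuous_cylRadius.comp continuous_snd).tendsto zs).comp hlim)
      fun k => (hx (φ k)).2.1.le
  have hzsax : cylRadius zs.2 ≠ 0 := by
    intro h0
    rw [h0] at hρs
    linarith
  rcases ht.lt_or_eq with hlt | heq
  · -- ### `t* < 0`: continuity of `DⁿV` at `z*`
    have hapos : (0 : ℝ) < (⌈‖zs.2‖ + |zs.1|⌉₊ : ℝ) + 1 := by positivity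
    have hzO := mem_offAxisRegion_natCeil hlt hzsax
    have hV := isSmoothAxisymmetricSolutionOn_offAxisRegion haxis hVcl hapos
    have hc : ContinuousAt F zs :=
      ((hV.continuousOn_iteratedFDeriv n).norm).continuousAt
        ((isOpen_Ioo.prod (isOpen_ball_inter_cylRadius_ne _)).mem_nhds hzO)
    have hev : ∀ᶠ k in atTop, F (x (φ k)) ≤ F zs + 1 :=
      (hc.tendsto.comp hlim).eventually (eventually_le_nhds (lt_add_one _))
    exact false_of_eventually_norm_le_of_lt hφ hxF hev
  · -- ### `t* = 0`: backward regularity at the off-axis top point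
    have hzsA : zs ∉ A := fun h => hzsax (haxis zs h)
    have hbd : ∃ r > 0, eLpNorm (uncurry w) ∞ (volume.restrict (parabolicCylinder r zs)) < ∞ := by
      by_contra h
      exact hzsA (by rw [hA]; exact ⟨ht, h⟩)
    obtain ⟨r, hr, hfin⟩ := hbd
    -- a smaller backward cylinder, off the axis
    set r₁ : ℝ := min r (δ / 2) with hr₁
    have hr₁pos : 0 < r₁ := lt_min hr (by linarith)
    have hr₁r : r₁ ≤ r := min_le_left _ _
    have hr₁δ : r₁ ≤ δ / 2 := min_le_right _ _
    have hsub₁ : parabolicCylinder r₁ zs ⊆ parabolicCylinder r zs :=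
      parabolicCylinder_mono hr₁pos.le hr₁r zs
    have hfin₁ : eLpNorm (uncurry w) ∞ (volume.restrict (parabolicCylinder r₁ zs)) < ∞ :=
      (eLpNorm_mono_measure _ (Measure.restrict_mono hsub₁ le_rfl)).trans_lt hfin
    have hoff : parabolicCylinder r₁ zs ⊆
        {z : ℝ × EuclideanSpace ℝ (Fin 3) | z.1 < 0 ∧ cylRadius z.2 ≠ 0} := by
      intro q hq
      rw [mem_parabolicCylinder] at hq
      refine ⟨by linarith [hq.1.2], fun h0 => ?_⟩
      have h1 := cylRadius_le_cylRadius_add_norm_sub'' zs.2 q.2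
      rw [h0, zero_add, ← dist_eq_norm, dist_comm] at h1
      linarith [hq.2]
    have hVc : ContinuousOn (uncurry V) (parabolicCylinder r₁ zs) :=
      (velocity_repr_offAxis haxis hVcl).1.mono hoff
    obtain ⟨hapos, hsub0⟩ := parabolicCylinder_subset_parabolicCylinder_zero ht hr₁pos
    have hae : uncurry w =ᵐ[volume.restrict (parabolicCylinder r₁ zs)] uncurry V :=
      ae_restrict_of_ae_restrict_of_subset hsub0 (hVae _ hapos)
    obtain ⟨r', hr', K, hK⟩ := exists_norm_iteratedFDeriv_le_of_backward_bounded w π hball zs r₁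
      ht hr₁pos hfin₁ V hVc hae n
    -- the tail of the sequence lies in `Q(z*, r')`
    have hopen : IsOpen (Ioi (zs.1 - r' ^ 2) ×ˢ ball zs.2 r') := isOpen_Ioi.prod isOpen_ball
    have hzsU : zs ∈ Ioi (zs.1 - r' ^ 2) ×ˢ ball zs.2 r' :=
      ⟨by simp only [mem_Ioi]; nlinarith, mem_ball_self hr'⟩
    have hev : ∀ᶠ k in atTop, F (x (φ k)) ≤ K := by
      filter_upwards [hlim.eventually_mem (hopen.mem_nhds hzsU)] with k hk
      refine hK _ ?_
      rw [mem_parabolicCylinder]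
      exact ⟨⟨hk.1, heq ▸ (hx (φ k)).1.2⟩, hk.2⟩
    exact false_of_eventually_norm_le_of_lt hφ hxF hev

/-! ### Pointwise algebra: the derivatives of `Γ = swirl V` against those of `V` -/

/-- **The derivatives of the swirl at an off-axis point, bounded by those of the field**: if
`‖V‖ ≤ B₀`, `‖DV‖ ≤ B₁`, `‖D²V‖ ≤ B₂` at `x` with `|x'| ≤ ρ`, `|x'| ≥ δ > 0`, then
`‖DΓ‖ ≤ ρB₁ + B₀`, `|∂ₑ∂ₑΓ| ≤ ρB₂ + 2B₁` for `‖e‖ ≤ 1`, and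
`|ΔΓ - DΓ[V] - (2/ϱ)∂_ϱΓ| ≤ 3ρB₂ + 4B₁ + (ρB₁ + B₀)(B₀ + 2/δ)` (the tree's formulas for `DΓ`,
`∂ₑ∂ₑΓ`, `ΔΓ`, with `|Jx| = |x'|`, `|Je| ≤ ‖e‖`). [folklore] -/
theorem swirl_derivs_le_of_norm_le {u : EuclideanSpace ℝ (Fin 3) → EuclideanSpace ℝ (Fin 3)}
    {x : EuclideanSpace ℝ (Fin 3)} (hu : ContDiffAt ℝ (⊤ : ℕ∞) u x) {δ ρ B₀ B₁ B₂ : ℝ}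
    (hδ : 0 < δ) (hδx : δ ≤ cylRadius x) (hxρ : cylRadius x ≤ ρ) (hB₀ : 0 ≤ B₀) (hB₁ : 0 ≤ B₁)
    (hB₂ : 0 ≤ B₂) (h0 : ‖u x‖ ≤ B₀) (h1 : ‖fderiv ℝ u x‖ ≤ B₁)
    (h2 : ‖iteratedFDeriv ℝ 2 u x‖ ≤ B₂) :
    ‖fderiv ℝ (swirl u) x‖ ≤ ρ * B₁ + B₀ ∧
      (∀ e : EuclideanSpace ℝ (Fin 3), ‖e‖ ≤ 1 →
        |fderiv ℝ (fun y => fderiv ℝ (swirl u) y e) x e| ≤ ρ * B₂ + 2 * B₁) ∧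
      |(Δ (swirl u)) x - fderiv ℝ (swirl u) x (u x) -
          2 / cylRadius x * partialDeriv (eR x) (swirl u) x| ≤
        3 * ρ * B₂ + 4 * B₁ + (ρ * B₁ + B₀) * (B₀ + 2 / δ) := by
  have hρ : 0 ≤ ρ := le_trans (le_trans hδ.le hδx) hxρ
  have hd : DifferentiableAt ℝ u x := hu.differentiableAt (by simp)
  have eJ : ∀ v : EuclideanSpace ℝ (Fin 3), ‖rotGen v‖ = cylRadius v := fun v => norm_rotGen v
  have hJx : ‖rotGen x‖ ≤ ρ := (eJ x).le.trans hxρ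
  have hJe : ∀ e : EuclideanSpace ℝ (Fin 3), ‖rotGen e‖ ≤ ‖e‖ := fun e =>
    (eJ e).le.trans (SereginZajaczkowski2007.cylRadius_le_norm' e)
  have hDe : ∀ e : EuclideanSpace ℝ (Fin 3), ‖fderiv ℝ u x e‖ ≤ B₁ * ‖e‖ := fun e =>
    (ContinuousLinearMap.le_opNorm _ _).trans (mul_le_mul_of_nonneg_right h1 (norm_nonneg _))
  have hD2e : ∀ e : EuclideanSpace ℝ (Fin 3), ‖iteratedFDeriv ℝ 2 u x ![e, e]‖ ≤ B₂ * ‖e‖ * ‖e‖ := by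
    intro e
    calc ‖iteratedFDeriv ℝ 2 u x ![e, e]‖ ≤ ‖iteratedFDeriv ℝ 2 u x‖ * ∏ i, ‖(![e, e] : Fin 2 → _) i‖ :=
          ContinuousMultilinearMap.le_opNorm _ _
      _ = ‖iteratedFDeriv ℝ 2 u x‖ * (‖e‖ * ‖e‖) := by simp [Fin.prod_univ_two]
      _ ≤ B₂ * (‖e‖ * ‖e‖) := mul_le_mul_of_nonneg_right h2 (by positivity)
      _ = B₂ * ‖e‖ * ‖e‖ := by ring
  -- (1) the gradient
  have hgrad : ‖fderiv ℝ (swirl u) x‖ ≤ ρ * B₁ + B₀ := by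
    refine ContinuousLinearMap.opNorm_le_bound _ (by positivity) fun e => ?_
    rw [fderiv_swirl_apply hd e, Real.norm_eq_abs]
    calc |⟪rotGen x, fderiv ℝ u x e⟫ + ⟪rotGen e, u x⟫|
        ≤ |⟪rotGen x, fderiv ℝ u x e⟫| + |⟪rotGen e, u x⟫| := abs_add_le _ _
      _ ≤ ‖rotGen x‖ * ‖fderiv ℝ u x e‖ + ‖rotGen e‖ * ‖u x‖ :=
          add_le_add (abs_real_inner_le_norm _ _) (abs_real_inner_le_norm _ _)
      _ ≤ ρ * (B₁ * ‖e‖) + ‖e‖ * B₀ :=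
          add_le_add (mul_le_mul hJx (hDe e) (norm_nonneg _) hρ)
            (mul_le_mul (hJe e) h0 (norm_nonneg _) (norm_nonneg _))
      _ = (ρ * B₁ + B₀) * ‖e‖ := by ring
  refine ⟨hgrad, fun e he => ?_, ?_⟩
  · -- (2) the second derivatives
    have he0 : 0 ≤ ‖e‖ := norm_nonneg e
    rw [fderiv_fderiv_swirl_apply_of_contDiffAt hu e]
    calc |⟪rotGen x, iteratedFDeriv ℝ 2 u x ![e, e]⟫ + 2 * ⟪rotGen e, fderiv ℝ u x e⟫|
        ≤ |⟪rotGen x, iteratedFDeriv ℝ 2 u x ![e, e]⟫| + |2 * ⟪rotGen e, fderiv ℝ u x e⟫| :=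
          abs_add_le _ _
      _ ≤ ‖rotGen x‖ * ‖iteratedFDeriv ℝ 2 u x ![e, e]‖ + 2 * (‖rotGen e‖ * ‖fderiv ℝ u x e‖) := by
          rw [abs_mul, abs_two]
          exact add_le_add (abs_real_inner_le_norm _ _)
            (mul_le_mul_of_nonneg_left (abs_real_inner_le_norm _ _) two_pos.le)
      _ ≤ ρ * (B₂ * ‖e‖ * ‖e‖) + 2 * (‖e‖ * (B₁ * ‖e‖)) :=
          add_le_add (mul_le_mul hJx (hD2e e) (norm_nonneg _) hρ)
            (mul_le_mul_of_nonneg_left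
              (mul_le_mul (hJe e) (hDe e) (norm_nonneg _) he0) two_pos.le)
      _ ≤ ρ * (B₂ * 1 * 1) + 2 * (1 * (B₁ * 1)) := by
          gcongr
      _ = ρ * B₂ + 2 * B₁ := by ring
  · -- (3) the swirl operator
    have hn1 : ∀ j, ‖EuclideanSpace.basisFun (Fin 3) ℝ j‖ = 1 := fun j =>
      (EuclideanSpace.basisFun (Fin 3) ℝ).orthonormal.1 j
    have hΔu : ‖(Δ u) x‖ ≤ 3 * B₂ := by
      rw [congrFun (InnerProductSpace.laplacian_eq_iteratedFDeriv_orthonormalBasis u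
        (EuclideanSpace.basisFun (Fin 3) ℝ)) x]
      calc ‖∑ j, iteratedFDeriv ℝ 2 u x ![EuclideanSpace.basisFun (Fin 3) ℝ j,
              EuclideanSpace.basisFun (Fin 3) ℝ j]‖
          ≤ ∑ j, ‖iteratedFDeriv ℝ 2 u x ![EuclideanSpace.basisFun (Fin 3) ℝ j,
              EuclideanSpace.basisFun (Fin 3) ℝ j]‖ := norm_sum_le _ _
        _ ≤ ∑ _j : Fin 3, B₂ := Finset.sum_le_sum fun j _ => by
            have h := hD2e (EuclideanSpace.basisFun (Fin 3) ℝ j)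
            rwa [hn1, mul_one, mul_one] at h
        _ = 3 * B₂ := by simp
    have hcomp : ∀ (i j : Fin 3), |fderiv ℝ u x (EuclideanSpace.single i (1 : ℝ)) j| ≤ B₁ := by
      intro i j
      have h := hDe (EuclideanSpace.basisFun (Fin 3) ℝ i)
      rw [hn1, mul_one, EuclideanSpace.basisFun_apply] at h
      exact le_trans (by simpa using PiLp.norm_apply_le (fderiv ℝ u x (EuclideanSpace.single i 1)) j) h
    have hΔΓ : |(Δ (swirl u)) x| ≤ 3 * ρ * B₂ + 4 * B₁ := by
      rw [laplacian_swirl_of_contDiffAt hu]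
      have hA1 : |⟪rotGen x, (Δ u) x⟫| ≤ ρ * (3 * B₂) :=
        (abs_real_inner_le_norm _ _).trans (mul_le_mul hJx hΔu (norm_nonneg _) hρ)
      have ha := hcomp 0 1
      have hb := hcomp 1 0
      rw [abs_le] at hA1 ha hb ⊢
      constructor <;> linarith [hA1.1, hA1.2, ha.1, ha.2, hb.1, hb.2]
    have hconv : |fderiv ℝ (swirl u) x (u x)| ≤ (ρ * B₁ + B₀) * B₀ := by
      rw [← Real.norm_eq_abs]
      exact (ContinuousLinearMap.le_opNorm _ _).trans
        (mul_le_mul hgrad h0 (norm_nonneg _) (by positivity))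
    have hrad : |2 / cylRadius x * partialDeriv (eR x) (swirl u) x| ≤ 2 / δ * (ρ * B₁ + B₀) := by
      have hx0 : 0 < cylRadius x := lt_of_lt_of_le hδ hδx
      have h1' : 0 ≤ 2 / cylRadius x := div_nonneg two_pos.le hx0.le
      have h1'' : 2 / cylRadius x ≤ 2 / δ := div_le_div_of_nonneg_left two_pos.le hδ hδx
      have h2' : ‖fderiv ℝ (swirl u) x (eR x)‖ ≤ ρ * B₁ + B₀ :=
        (ContinuousLinearMap.le_opNorm _ _).trans
          ((mul_le_mul hgrad (norm_eR_le_one x) (norm_nonneg _) (by positivity)).trans_eq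
            (mul_one _))
      rw [partialDeriv_apply, abs_mul, abs_of_nonneg h1', ← Real.norm_eq_abs]
      exact mul_le_mul h1'' h2' (norm_nonneg _) (by positivity)
    calc |(Δ (swirl u)) x - fderiv ℝ (swirl u) x (u x) -
          2 / cylRadius x * partialDeriv (eR x) (swirl u) x|
        ≤ |(Δ (swirl u)) x| + |fderiv ℝ (swirl u) x (u x)| +
          |2 / cylRadius x * partialDeriv (eR x) (swirl u) x| :=
          (abs_sub _ _).trans (add_le_add (abs_sub _ _) le_rfl)
      _ ≤ (3 * ρ * B₂ + 4 * B₁) + (ρ * B₁ + B₀) * B₀ + 2 / δ * (ρ * B₁ + B₀) :=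
          add_le_add (add_le_add hΔΓ hconv) hrad
      _ = 3 * ρ * B₂ + 4 * B₁ + (ρ * B₁ + B₀) * (B₀ + 2 / δ) := by ring

/-! ### The bounds for `Π = c + s Γ` -/

/-- **The clause "`π ∈ W^{2,1}_2(P(δ, R; R) × ]-R², 0[)`" of the class 𝒱 for `Π = c + s Γ`, in
the tree's rendering: `∂ₜΠ`, `∇Π` and `∂ₑ∂ₑΠ` (`‖e‖ ≤ 1`) are bounded on every box
`]-ρ², 0[ × {δ < |x'| < ρ, |x₃| < ρ}`, `0 < δ < ρ`.** From the uniform bounds of `V`, `DV`, `D²V`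
on the box (`exists_norm_iteratedFDeriv_le_offAxisBox`), the pointwise algebra
`swirl_derivs_le_of_norm_le`, and `∂ₜΠ = s(ΔΓ - DΓ[V] - (2/ϱ)∂_ϱΓ)` (`affSwirl_classV_time`),
`∇Π = s∇Γ`, `∂ₑ∂ₑΠ = s∂ₑ∂ₑΓ`. [cite: Seregin2020, proof of Thm 2.1, the class 𝒱 (ii) (arXiv p. 8)] -/
theorem affSwirl_classV_bounds :
    ∀ (w V : ℝ → EuclideanSpace ℝ (Fin 3) → EuclideanSpace ℝ (Fin 3))
      (π : ℝ → EuclideanSpace ℝ (Fin 3) → ℝ) (A : Set (ℝ × EuclideanSpace ℝ (Fin 3))),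
      (∀ a : ℝ, 0 < a → IsSuitableWeakSolutionInBall a 0 w π) →
      A = {z : ℝ × EuclideanSpace ℝ (Fin 3) | z.1 ≤ 0 ∧
        ¬ ∃ r > 0, eLpNorm (uncurry w) ∞ (volume.restrict (parabolicCylinder r z)) < ∞} →
      (∀ z ∈ A, cylRadius z.2 = 0) →
      (∀ a : ℝ, 0 < a →
        uncurry w =ᵐ[volume.restrict (parabolicCylinder a (0 : ℝ × EuclideanSpace ℝ (Fin 3)))]
          uncurry V) →
      (∀ a : ℝ, 0 < a → ∀ O : TopologicalSpace.Opens (ℝ × EuclideanSpace ℝ (Fin 3)),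
        (O : Set (ℝ × EuclideanSpace ℝ (Fin 3))) ⊆
          parabolicCylinder a (0 : ℝ × EuclideanSpace ℝ (Fin 3)) \ A →
        (∀ θ : ℝ, ∀ z ∈ (O : Set (ℝ × EuclideanSpace ℝ (Fin 3))),
          ((z.1, rotZ θ z.2) : ℝ × EuclideanSpace ℝ (Fin 3)) ∈
            (O : Set (ℝ × EuclideanSpace ℝ (Fin 3)))) →
        SereginZajaczkowski2007.IsSmoothAxisymmetricSolutionOn O V π) →
      ∀ (c s : ℝ),
    ∀ δ ρ : ℝ, 0 < δ → δ < ρ → ∃ C : ℝ, ∀ z : ℝ × EuclideanSpace ℝ (Fin 3),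
      z.1 ∈ Ioo (-ρ ^ 2) 0 → δ < cylRadius z.2 → cylRadius z.2 < ρ → |z.2 2| < ρ →
        |deriv (fun r => c + s * swirl (V r) z.2) z.1| ≤ C ∧
        ‖fderiv ℝ (fun y => c + s * swirl (V z.1) y) z.2‖ ≤ C ∧
        ∀ e : EuclideanSpace ℝ (Fin 3), ‖e‖ ≤ 1 →
          |fderiv ℝ (fun y => fderiv ℝ (fun y => c + s * swirl (V z.1) y) y e) z.2 e| ≤ C := by
  intro w V π A hball hA haxis hVae hVcl c s δ ρ hδ hδρ
  obtain ⟨C₀, hC₀⟩ := exists_norm_iteratedFDeriv_le_offAxisBox (ρ := ρ) hball hA haxis hVae hVcl hδ 0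
  obtain ⟨C₁, hC₁⟩ := exists_norm_iteratedFDeriv_le_offAxisBox (ρ := ρ) hball hA haxis hVae hVcl hδ 1
  obtain ⟨C₂, hC₂⟩ := exists_norm_iteratedFDeriv_le_offAxisBox (ρ := ρ) hball hA haxis hVae hVcl hδ 2
  set B₀ : ℝ := max C₀ 0 with hB₀
  set B₁ : ℝ := max C₁ 0 with hB₁
  set B₂ : ℝ := max C₂ 0 with hB₂
  have hB₀0 : 0 ≤ B₀ := le_max_right _ _
  have hB₁0 : 0 ≤ B₁ := le_max_right _ _
  have hB₂0 : 0 ≤ B₂ := le_max_right _ _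
  have hρ : 0 ≤ ρ := by linarith
  obtain ⟨hD, -, -, -⟩ := affSwirl_classV_time V π A haxis hVcl c s
  refine ⟨|s| * ((3 * ρ * B₂ + 4 * B₁ + (ρ * B₁ + B₀) * (B₀ + 2 / δ)) + (ρ * B₁ + B₀) +
    (ρ * B₂ + 2 * B₁)), fun z ht hδz hzρ h3 => ?_⟩
  have hz : z.1 < 0 := ht.2
  have hzax : cylRadius z.2 ≠ 0 := by
    intro h0
    rw [h0] at hδz
    linarith
  -- the class near the point and the bounds of `V`, `DV`, `D²V` there
  have hapos : (0 : ℝ) < (⌈‖z.2‖ + |z.1|⌉₊ : ℝ) + 1 := by positivity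
  have hzO := mem_offAxisRegion_natCeil hz hzax
  have hV := isSmoothAxisymmetricSolutionOn_offAxisRegion haxis hVcl hapos
  have hsm : ContDiffAt ℝ (⊤ : ℕ∞) (V z.1) z.2 := hV.contDiffAt z hzO
  have h0 : ‖V z.1 z.2‖ ≤ B₀ := by
    have h := hC₀ z ht hδz hzρ h3
    rw [norm_iteratedFDeriv_zero] at h
    exact h.trans (le_max_left _ _)
  have h1 : ‖fderiv ℝ (V z.1) z.2‖ ≤ B₁ := by
    have h := hC₁ z ht hδz hzρ h3
    rw [norm_iteratedFDeriv_one] at h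
    exact h.trans (le_max_left _ _)
  have h2 : ‖iteratedFDeriv ℝ 2 (V z.1) z.2‖ ≤ B₂ := (hC₂ z ht hδz hzρ h3).trans (le_max_left _ _)
  obtain ⟨hg, hss, hop⟩ := swirl_derivs_le_of_norm_le hsm hδ hδz.le hzρ.le hB₀0 hB₁0 hB₂0 h0 h1 h2
  have hs0 : 0 ≤ |s| := abs_nonneg s
  have hT1 : 0 ≤ 3 * ρ * B₂ + 4 * B₁ + (ρ * B₁ + B₀) * (B₀ + 2 / δ) := by positivity
  have hT2 : 0 ≤ ρ * B₁ + B₀ := by positivity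
  have hT3 : 0 ≤ ρ * B₂ + 2 * B₁ := by positivity
  -- `∇Π = s ∇Γ`, near the point (for the second derivatives) and at the point
  have hgradeq : ∀ w ∈ ((⟨Ioo (-(((⌈‖z.2‖ + |z.1|⌉₊ : ℝ) + 1) ^ 2)) 0 ×ˢ
      (ball (0 : EuclideanSpace ℝ (Fin 3)) ((⌈‖z.2‖ + |z.1|⌉₊ : ℝ) + 1) ∩ {y | cylRadius y ≠ 0}),
        isOpen_Ioo.prod (isOpen_ball_inter_cylRadius_ne _)⟩ : Opens (ℝ × EuclideanSpace ℝ (Fin 3))) :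
        Set (ℝ × EuclideanSpace ℝ (Fin 3))),
      fderiv ℝ (fun y => c + s * swirl (V w.1) y) w.2 = s • fderiv ℝ (swirl (V w.1)) w.2 := by
    intro w hw
    rw [fderiv_const_add, fderiv_const_mul ((hV.contDiffAt_swirl hw).differentiableAt (by simp))]
  refine ⟨?_, ?_, fun e he => ?_⟩
  · -- `∂ₜΠ`
    rw [(hD z hz hzax).deriv, abs_mul]
    calc |s| * |(Δ (swirl (V z.1))) z.2 - fderiv ℝ (swirl (V z.1)) z.2 (V z.1 z.2) -
          2 / cylRadius z.2 * partialDeriv (eR z.2) (swirl (V z.1)) z.2|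
        ≤ |s| * (3 * ρ * B₂ + 4 * B₁ + (ρ * B₁ + B₀) * (B₀ + 2 / δ)) :=
          mul_le_mul_of_nonneg_left hop hs0
      _ ≤ _ := by nlinarith
  · -- `∇Π`
    rw [hgradeq z hzO, norm_smul, Real.norm_eq_abs]
    calc |s| * ‖fderiv ℝ (swirl (V z.1)) z.2‖ ≤ |s| * (ρ * B₁ + B₀) :=
          mul_le_mul_of_nonneg_left hg hs0
      _ ≤ _ := by nlinarith
  · -- `∂ₑ∂ₑΠ`
    have hloc : (fun y => fderiv ℝ (fun y => c + s * swirl (V z.1) y) y e) =ᶠ[𝓝 z.2]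
        fun y => s * fderiv ℝ (swirl (V z.1)) y e := by
      filter_upwards [eventually_mem_slice (isOpen_Ioo.prod (isOpen_ball_inter_cylRadius_ne _)) hzO]
        with y hy
      rw [hgradeq (z.1, y) hy]
      rfl
    rw [hloc.fderiv_eq, fderiv_const_mul (hV.differentiableAt_fderiv_swirl_apply e hzO)]
    simp only [smul_apply, smul_eq_mul, abs_mul]
    calc |s| * |fderiv ℝ (fun y => fderiv ℝ (swirl (V z.1)) y e) z.2 e| ≤ |s| * (ρ * B₂ + 2 * B₁) :=
          mul_le_mul_of_nonneg_left (hss e he) hs0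
      _ ≤ _ := by nlinarith

end Bounds

end Summit.NavierStokesRegularity.NavierStokesRegularity.Theorems.AxisymmetricKatoGlobal.EulerScaling

end
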